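import Summits.CriticalPhenomena.SAWScalingLimit.Theorems.SAWLeftRightFKGLeftRightFKGDefs
import Summits.CriticalPhenomena.SAWScalingLimit.Theorems.LeftRightFKG.Negative.OrderCharacterisation
import HarnessLib

/-!
# Crux `LeftRightFKG` (stmt-CriticalPhenomena-11232), line `corner-localisation` (v9):
first/last-step events at a bottom-row marked point are monotone (`stub_firstStepMonotone`, tool T2)

In every domain `Ω` at mesh `δ = 1`, unconditionally: if all vertices of two chords `γ₁ ≼ γ₂`
(`CornerLoc.lr`: the lens loop `γ₁ · γ₂⁻¹` winds non-negatively about every point) lie weakly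
above the row of `a`, then "first step West" passes up (`γ₁` starts West ⇒ `γ₂` starts West) and
"first step East" passes down (`γ₂` starts East ⇒ `γ₁` starts East); mirror statement at `b` for
the last step.

Mechanism. `lr` forces `wcross m k γ₁ ≤ wcross m k γ₂` at every face `(m, k)` (landed
`Negative.wcross_le_of_wind_nonneg`, height ceiling read off the two finite supports as in
`NotFKGAtOne.le_wcross_of_lrLE`). For a self-avoiding walk `w` from `u = (i, Y₀)` to `v ≠ u` all of
whose vertices have height `≥ Y₀`, and `m ∈ {i - 1, i}`, FLOW CONSERVATION gives
`wcross m Y₀ w = [m + 1 ≤ v 0] - [m + 1 ≤ (w 1) 0]` (`wcross_bottom`): the first dart leaves the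
bottom row point `u` and is not counted at level `Y₀`, and along the remaining walk, which avoids
`u` (self-avoidance) and hence never uses the unique height-`Y₀` edge across the line
`x = m + ½`, every dart changes the indicator `[m + 1 ≤ · 0]` by exactly its signed crossing
number (`wcross_eq_flow`, telescoping). Comparing the two chords at the faces `(i - 1, Y₀)` and
`(i, Y₀)` pins the first steps (`firstStep_of_wcross_le`); the statement at `b` is the same
applied to the reversed chords (`Negative.wcross_reverse`). No named facts are used. [folklore]
-/

open Literature.Probability.LatticeModels Literature.Probability.RandomPlanarGeometry
open Summit.CriticalPhenomena.SAWScalingLimit.Theorems.LeftRightFKG.Negative (bx pathCross wcross)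
open Summit.CriticalPhenomena.SAWScalingLimit.Theorems.LeftRightFKG.CornerLoc (lr IsUp μx dom IsInst)

namespace Summit.CriticalPhenomena.SAWScalingLimit.Theorems.LeftRightFKG.Families

/-! ## Crossing counts of walks leaving a bottom-row point -/

section Walks

variable {G : SimpleGraph (Site 2)}

/-- A site equals `bx i j` iff its coordinates are `i`, `j`. [folklore] -/
private theorem eq_bx_iff (v : Site 2) (i j : ℤ) : v = bx i j ↔ v 0 = i ∧ v 1 = j := by
  constructor
  · rintro rfl
    exact ⟨rfl, rfl⟩
  · rintro ⟨h0, h1⟩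
    rw [Negative.eq_bx v, h0, h1]

/-- Two distinct sites differ in a coordinate. [folklore] -/
private theorem coord_ne_of_ne {v u : Site 2} (h : v ≠ u) : v 0 ≠ u 0 ∨ v 1 ≠ u 1 := by
  by_contra hc
  simp only [not_or, not_not] at hc
  exact h ((eq_bx_iff v (u 0) (u 1)).2 hc ▸ (Negative.eq_bx u).symm)

/-- `wcross` of a walk with a first dart: the dart's crossing number plus the rest. [folklore] -/
private theorem wcross_cons (m k : ℤ) {u v w : Site 2} (h : G.Adj u v) (p : G.Walk v w) :
    wcross m k (SimpleGraph.Walk.cons h p) = Negative.edgeCross m k u v + wcross m k p := by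
  rw [Negative.wcross_eq_darts, Negative.wcross_eq_darts, SimpleGraph.Walk.darts_cons, List.map_cons,
    List.sum_cons]

/-- FLOW CONSERVATION along a walk avoiding the bottom-row point `u`. If every vertex of the walk
`p : v ⟶ w` of a lattice subgraph has height `≥ u 1`, `p` avoids `u`, and `u 0 ∈ {m, m + 1}` (so the
only height-`(u 1)` edge across the line `x = m + ½` has `u` as an endpoint and is not used), then
the level-`(u 1)` crossing count of `p` is the net flow `[m + 1 ≤ w 0] - [m + 1 ≤ v 0]`: each dart
changes the indicator `[m + 1 ≤ · 0]` by exactly its signed crossing number. [folklore] -/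
private theorem wcross_eq_flow (hG : ∀ x y, G.Adj x y → (zdGraph 2).Adj x y) (m : ℤ) (u : Site 2) :
    ∀ {v w : Site 2} (p : G.Walk v w), (∀ x ∈ p.support, u 1 ≤ x 1) → u ∉ p.support →
      (u 0 = m ∨ u 0 = m + 1) →
      wcross m (u 1) p = (if m + 1 ≤ w 0 then 1 else 0) - (if m + 1 ≤ v 0 then 1 else 0)
  | v, _, SimpleGraph.Walk.nil, _, _, _ => by
    show pathCross m (u 1) v [] = _
    rw [Negative.pathCross_nil, sub_self]
  | v, w, SimpleGraph.Walk.cons (v := v') h p, hY, hu, hm => by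
    have hY' : ∀ x ∈ p.support, u 1 ≤ x 1 := fun x hx =>
      hY x (by rw [SimpleGraph.Walk.support_cons]; exact List.mem_cons_of_mem _ hx)
    have hu' : u ∉ p.support := fun hx =>
      hu (by rw [SimpleGraph.Walk.support_cons]; exact List.mem_cons_of_mem _ hx)
    rw [wcross_cons, wcross_eq_flow hG m u p hY' hu' hm]
    have hv : u 1 ≤ v 1 := hY v (SimpleGraph.Walk.start_mem_support _)
    have hv' : u 1 ≤ v' 1 := hY' v' (SimpleGraph.Walk.start_mem_support _)
    have hvu : v 0 ≠ u 0 ∨ v 1 ≠ u 1 :=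
      coord_ne_of_ne fun h' => hu (h' ▸ SimpleGraph.Walk.start_mem_support _)
    have hv'u : v' 0 ≠ u 0 ∨ v' 1 ≠ u 1 :=
      coord_ne_of_ne fun h' => hu' (h' ▸ SimpleGraph.Walk.start_mem_support _)
    have hadj := Negative.adj_cases (hG _ _ h)
    unfold Negative.edgeCross
    split_ifs <;> omega

/-- THE BOTTOM-ROW CROSSING FORMULA. For a self-avoiding walk `w : u ⟶ v`, `u ≠ v`, all of whose
vertices have height `≥ u 1`, and `u 0 ∈ {m, m + 1}` (the faces `(u 0 - 1, u 1)`, `(u 0, u 1)` left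
and right of `u`): `wcross m (u 1) w = [m + 1 ≤ v 0] - [m + 1 ≤ (w.getVert 1) 0]` — the first dart
leaves `u` at height `u 1` and is not counted at level `u 1`, and the rest of the walk avoids `u`
(`wcross_eq_flow`). [folklore] -/
private theorem wcross_bottom (hG : ∀ x y, G.Adj x y → (zdGraph 2).Adj x y) (m : ℤ) {u v : Site 2}
    (w : G.Walk u v) (hw : w.IsPath) (huv : u ≠ v) (hY : ∀ x ∈ w.support, u 1 ≤ x 1)
    (hm : u 0 = m ∨ u 0 = m + 1) :
    wcross m (u 1) w =
      (if m + 1 ≤ v 0 then 1 else 0) - (if m + 1 ≤ (w.getVert 1) 0 then 1 else 0) := by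
  cases w with
  | nil => exact absurd rfl huv
  | cons h q =>
    rw [SimpleGraph.Walk.cons_isPath_iff] at hw
    have hY' : ∀ x ∈ q.support, u 1 ≤ x 1 := fun x hx =>
      hY x (by rw [SimpleGraph.Walk.support_cons]; exact List.mem_cons_of_mem _ hx)
    rw [wcross_cons, wcross_eq_flow hG m u q hY' hw.2 hm, SimpleGraph.Walk.getVert_cons_succ,
      SimpleGraph.Walk.getVert_zero]
    unfold Negative.edgeCross
    split_ifs <;> omega

/-- FIRST STEPS ARE PINNED BY THE CROSSING COUNTS AT THE TWO BOTTOM FACES. For two self-avoiding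
walks `w₁, w₂ : u ⟶ v` (`u ≠ v`) with all vertices of height `≥ u 1` and
`wcross m (u 1) w₁ ≤ wcross m (u 1) w₂` for `m = u 0 - 1` and `m = u 0`: if `w₁` starts West so does
`w₂`, and if `w₂` starts East so does `w₁`. [folklore] -/
private theorem firstStep_of_wcross_le (hG : ∀ x y, G.Adj x y → (zdGraph 2).Adj x y) {u v : Site 2}
    (w₁ w₂ : G.Walk u v) (h₁ : w₁.IsPath) (h₂ : w₂.IsPath) (huv : u ≠ v)
    (hY₁ : ∀ x ∈ w₁.support, u 1 ≤ x 1) (hY₂ : ∀ x ∈ w₂.support, u 1 ≤ x 1)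
    (hW : wcross (u 0 - 1) (u 1) w₁ ≤ wcross (u 0 - 1) (u 1) w₂)
    (hE : wcross (u 0) (u 1) w₁ ≤ wcross (u 0) (u 1) w₂) :
    (w₁.getVert 1 = bx (u 0 - 1) (u 1) → w₂.getVert 1 = bx (u 0 - 1) (u 1)) ∧
    (w₂.getVert 1 = bx (u 0 + 1) (u 1) → w₁.getVert 1 = bx (u 0 + 1) (u 1)) := by
  rw [wcross_bottom hG (u 0 - 1) w₁ h₁ huv hY₁ (Or.inr (by ring)),
    wcross_bottom hG (u 0 - 1) w₂ h₂ huv hY₂ (Or.inr (by ring)), sub_le_sub_iff_left] at hW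
  rw [wcross_bottom hG (u 0) w₁ h₁ huv hY₁ (Or.inl rfl),
    wcross_bottom hG (u 0) w₂ h₂ huv hY₂ (Or.inl rfl), sub_le_sub_iff_left] at hE
  have hlen : ∀ w : G.Walk u v, 0 < w.length := fun w => by
    rcases Nat.eq_zero_or_pos w.length with h0 | h0
    · exact absurd (w.eq_of_length_eq_zero h0) huv
    · exact h0
  have hadj : ∀ w : G.Walk u v, (zdGraph 2).Adj u (w.getVert 1) := fun w => by
    have key := w.adj_getVert_succ (hlen w)
    rw [SimpleGraph.Walk.getVert_zero] at key
    exact hG _ _ key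
  have ha₁ := Negative.adj_cases (hadj w₁)
  have ha₂ := Negative.adj_cases (hadj w₂)
  have hy₁ : u 1 ≤ (w₁.getVert 1) 1 := hY₁ _ (w₁.getVert_mem_support 1)
  have hy₂ : u 1 ≤ (w₂.getVert 1) 1 := hY₂ _ (w₂.getVert_mem_support 1)
  simp only [eq_bx_iff]
  constructor
  · rintro ⟨h0, h1⟩
    split_ifs at hW hE <;> omega
  · rintro ⟨h0, h1⟩
    split_ifs at hW hE <;> omega

end Walks

/-! ## The registered stub -/

/-- `lr γ₁ γ₂` forces `wcross m k γ₁ ≤ wcross m k γ₂` at every face `(m, k)` — in every domain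
(`δ = 1`): `Negative.wcross_le_of_wind_nonneg` with the height ceiling read off the two finite
supports (pattern of `NotFKGAtOne.le_wcross_of_lrLE`). [folklore] -/
private theorem wcross_le_of_lr {Ω : Set ℂ} {a b : Site 2} (γ₁ γ₂ : SAW.DomainSAW Ω 1 a b)
    (h : lr γ₁ γ₂) (m k : ℤ) : wcross m k γ₁.walk ≤ wcross m k γ₂.walk := by
  have hG : ∀ x y, (discreteDomainGraph Ω 1).Adj x y → (zdGraph 2).Adj x y := fun x y hxy =>
    meshGraph_le_zdGraph Ω 1 (discreteDomainGraph_le_meshGraph Ω 1 hxy)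
  classical
  obtain ⟨Y, hY⟩ := Finset.exists_le
    (insert k (((γ₁.walk.support ++ γ₂.walk.support).map fun x : Site 2 => x 1).toFinset))
  have hkY : k ≤ Y := hY k (Finset.mem_insert_self _ _)
  have hs : ∀ x ∈ γ₁.walk.support ++ γ₂.walk.support, x 1 ≤ Y := fun x hx =>
    hY (x 1) (Finset.mem_insert_of_mem (List.mem_toFinset.2 (List.mem_map.2 ⟨x, hx, rfl⟩)))
  exact Negative.wcross_le_of_wind_nonneg hG γ₁.walk γ₂.walk hkY
    (fun x hx => hs x (List.mem_append_left _ hx))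
    (fun x hx => hs x (List.mem_append_right _ hx)) (h (Negative.probeL m k))

/-- STUB T2 `stub_firstStepMonotone` of line `corner-localisation` (crux `LeftRightFKG`,
stmt-CriticalPhenomena-11232): FIRST/LAST-STEP EVENTS AT A BOTTOM-ROW MARKED POINT ARE MONOTONE —
in every domain (`δ = 1`), unconditionally. If all vertices of two chords `γ₁ ≼ γ₂` (`lr`) lie
weakly above the row of `a`, then "first step West" passes up (`γ₁` starts West ⇒ `γ₂` starts
West) and "first step East" passes down (`γ₂` starts East ⇒ `γ₁` starts East); mirror at `b` for
the last step (from the East passes up, from the West passes down). Proof: `lr` gives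
`wcross m k γ₁ ≤ wcross m k γ₂` at every face (`wcross_le_of_lr`); at the faces `(a 0 - 1, a 1)`
and `(a 0, a 1)` the count is the net flow across the line `x = m + ½` minus the contribution of
the first dart (`wcross_bottom`), which pins the first steps (`firstStep_of_wcross_le`); at `b`
the same for the reversed chords (`Negative.wcross_reverse`). [folklore] -/
theorem stub_firstStepMonotone : ∀ (Ω : Set ℂ) (a b : Site 2) (γ₁ γ₂ : SAW.DomainSAW Ω 1 a b), a ≠ b → lr γ₁ γ₂ →
    ((∀ v ∈ γ₁.walk.support, a 1 ≤ v 1) → (∀ v ∈ γ₂.walk.support, a 1 ≤ v 1) →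
      (γ₁.walk.getVert 1 = bx (a 0 - 1) (a 1) → γ₂.walk.getVert 1 = bx (a 0 - 1) (a 1)) ∧
      (γ₂.walk.getVert 1 = bx (a 0 + 1) (a 1) → γ₁.walk.getVert 1 = bx (a 0 + 1) (a 1))) ∧
    ((∀ v ∈ γ₁.walk.support, b 1 ≤ v 1) → (∀ v ∈ γ₂.walk.support, b 1 ≤ v 1) →
      (γ₁.walk.reverse.getVert 1 = bx (b 0 + 1) (b 1) → γ₂.walk.reverse.getVert 1 = bx (b 0 + 1) (b 1)) ∧
      (γ₂.walk.reverse.getVert 1 = bx (b 0 - 1) (b 1) → γ₁.walk.reverse.getVert 1 = bx (b 0 - 1) (b 1))) := by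
  intro Ω a b γ₁ γ₂ hab hlr
  have hG : ∀ x y, (discreteDomainGraph Ω 1).Adj x y → (zdGraph 2).Adj x y := fun x y hxy =>
    meshGraph_le_zdGraph Ω 1 (discreteDomainGraph_le_meshGraph Ω 1 hxy)
  have H := wcross_le_of_lr γ₁ γ₂ hlr
  refine ⟨fun ha₁ ha₂ => ?_, fun hb₁ hb₂ => ?_⟩
  · exact firstStep_of_wcross_le hG γ₁.walk γ₂.walk γ₁.isPath γ₂.isPath hab ha₁ ha₂
      (H (a 0 - 1) (a 1)) (H (a 0) (a 1))
  · have hR : ∀ m k : ℤ, wcross m k γ₂.walk.reverse ≤ wcross m k γ₁.walk.reverse := fun m k => by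
      rw [Negative.wcross_reverse, Negative.wcross_reverse]
      exact neg_le_neg (H m k)
    have hs : ∀ (γ : SAW.DomainSAW Ω 1 a b), (∀ v ∈ γ.walk.support, b 1 ≤ v 1) →
        ∀ x ∈ γ.walk.reverse.support, b 1 ≤ x 1 := fun γ hγ x hx =>
      hγ x (by rwa [SimpleGraph.Walk.support_reverse, List.mem_reverse] at hx)
    have key := firstStep_of_wcross_le hG γ₂.walk.reverse γ₁.walk.reverse
      ((SimpleGraph.Walk.isPath_reverse_iff _).2 γ₂.isPath)
      ((SimpleGraph.Walk.isPath_reverse_iff _).2 γ₁.isPath) hab.symm (hs γ₂ hb₂) (hs γ₁ hb₁)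
      (hR (b 0 - 1) (b 1)) (hR (b 0) (b 1))
    exact ⟨key.2, key.1⟩

end Summit.CriticalPhenomena.SAWScalingLimit.Theorems.LeftRightFKG.Families
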